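/-
Copyright (c) 2026 the pub-hodgecm-mathlib formalisation cell (harness21).  Prover seat hodgecm-mathlib-LH6-p04 (g11), 2026-09-03.  E1 row 41g «(SS-K) UNIFORM @ DATUM»
(E1 keeper ∕ dealer F0P3a-p03 (g29) 02:06:13Z), FILE P «THE (U)-COLUMN PACKAGED FOR THE SCHNEIDER–STUHLER COMPLEX» (sigsheet SIG-R41G v1 b96b08c7).
-/
import Literature.NumberTheory.Automorphic.UnitaryLatticeTreeGeodesicInclusion      -- ★ δ (LH6-p04 g11): (U7) subtype head, transport `mem_unitaryLevel_mapGL_iff`; brings ★ α∕β∕γ, rows 22, Defs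
import Literature.NumberTheory.Automorphic.UnitaryLatticeTreeEdgeLevelGroup         -- ★ row 22b (F0P3a-p01 g23): (U6)-lite `levelSubgroup_le_normalizer_of_edge` ∕ `…'`, (i) `mapGL_eq_of_mem_levelSubgroup_succ_of_edge` ∕ `…'`
import Literature.NumberTheory.Automorphic.UnitaryLatticeTreeLevelGroupsTopology    -- ★ row 43 (LH5-p04 g10): level groups open ∕ compact, stabilisers open ∕ compact, unitary restriction
import Literature.NumberTheory.Automorphic.UnitaryLatticeTreeInvariantOrientation   -- ★ row 30b (LH5-p05 g11): the invariant orientation `τ.tail e < τ.head e`, `head_mapEdgeSet_latticeGraphIso`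
import Literature.NumberTheory.Automorphic.UnitaryLatticeTreeFixedChildCountTransportRamified   -- ★ `latticeGraphIso_one_apply`, `latticeGraphIso_mul_apply` (any `N`, any form)
import Literature.NumberTheory.Automorphic.UnitaryLatticeTreeStar                   -- ★ `latticeGraph_adj_iff_lt_of_…`, `scaleLattice_le_of_lt` via Apartment: the edge shape `ϖM ≤ M′ < M` at `N = 3`
import Literature.Combinatorics.SimpleGraph.LocallyFiniteBall                         -- ★ row 41b (F0P3a-p02 g28): `finite_edgeSet_inside`
import Mathlib.Algebra.Order.Group.End                                                 -- `RelIso` group: `mul_apply`, `one_apply`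
import HarnessLib

/-!
# The lattice graph of a hermitian space — THE (U)-COLUMN PACKAGED FOR THE SCHNEIDER–STUHLER COMPLEX: the action hom, the unitary level family, open∕compact vertex, edge and
# stabiliser groups, (U6) in the subtype group, transport `U_{u·x} = u U_x u⁻¹`, «level ≥ 1 fixes the closed star», normalisers, finite fixed edges ([SS97] Ch. I §2, lattice model)

Topic `NumberTheory/Automorphic`; namespace `Literature.NumberTheory.Automorphic.UnitaryLatticeTree` (T1a currency of ★ `UnitaryLatticeTreeDefs`).  THEOREMS ONLY (no definition,
no instance, no notation, no named fact, no `sorry`); kernel lane.  Cell `pub/hodgecm-mathlib` (D-0151), crux H413 = `stmt-HodgeConjecture-24833`; E1 BRICK LEDGER row 41g «(SS-K)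
UNIFORM @ DATUM» (keeper F0P3a-p03 (g29) 02:06:13Z), FILE P of two: every tree-side hypothesis of ★ 41f `Representation.levelTrace_eq_fixedVertexSum_sub_fixedEdgeSum` (F0P3a-p04
(g31)) that concerns the groups `U x`, their stabilisers and the action, stated once in the subtype group `Γ₀ = ↥(unitaryGroupOfForm σ H)` (the datum's `Gqs L v` up to the (G3) iso
`eA`) — hypothesis-style throughout (`hU`, `hP`, `ha`), with `∃`-suppliers and no definition.  HONEST LABEL: count-neutral generic∕model base layer of the (R-SS) resolution
engine (census E1 v1; census 38 §3 «MISSING datum = the (U)-column»); (R-SS) NOT chartered; HC_CM is proved only modulo the 2 remaining named inputs (hLiu418 24832, h413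
24833) until rung 0 closes; nothing printed is asserted here.

LETTERS.  `K` a field with `Valued K ℤᵐ⁰`, `σ : K →+* K`, `ϖ : K`, `H : Matrix (Fin N) (Fin N) K`, `Γ₀ := ↥(unitaryGroupOfForm σ H)`, vertices
`𝓥 := {M : Submodule 𝒪[K] (Fin N → K) // IsVertex σ ϖ H M}`, `G := latticeGraph σ ϖ H`, level token `LEV(M, c, g) :≡ M.map ((Matrix.toLin' (↑g − 1)).restrictScalars 𝒪[K]) ≤ scaleLattice c M`,
and the UNITARY LEVEL FAMILY hypothesis `hU : ∀ (x : 𝓥) (u : Γ₀), u ∈ U x ↔ mapGL ↑u x.1 = x.1 ∧ LEV(x.1, c, ↑u)` for `U : 𝓥 → Subgroup Γ₀` (rows 22∕22b∕δ; `c = ϖ^(e+1)`).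
* §1 `exists_monoidHom_latticeGraphIso` (41d's action letter `a : Γ₀ →* (G ≃g G)`), `exists_unitaryLevelFamily` (the family `U` at any level `c`), `exists_stabilizerSubgroup`.
* §2 OPEN ∕ COMPACT: `U x` (`0 < |c| < 1`; ★ row 43 §4), the vertex stabiliser `{u | u·x = x}` (★ row 43 §1∕§2 pulled back along the closed embedding `Γ₀ ↪ GL_N(K)`), and the edge group
  `U x ⊔ U y`.
* §3 (U6) IN `Γ₀`: for `G.Adj x y` (at `N = 3`, `Φ₃`, unramified datum: `ϖM ≤ M′ < M`) `↑(U x ⊔ U y) = ↑(U x) * ↑(U y)` (★ row 22b (ii) mutual normalisation restricted to `Γ₀` +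
  Mathlib `Subgroup.coe_mul_of_left_le_normalizer_right`).  (U7) is ★ δ `unitaryLevel_subset_mul_of_adj_of_dist_subtype` (cited, not restated).
* §4 TRANSPORT AND STARS: `U (u·x) = (U x).map (conj u)` (★ δ §1), `u·x = x → u ∈ N(U x)`, `u ∈ U x → u·x = x`, `u ∈ U x → G.Adj x y → u·y = y` (`c = ϖ^(e+1)`: level ≥ 1 fixes
  the closed star, ★ row 22b (i)), and the fixed edges of `u` are finite when its fixed vertices are (★ row 30b: no inversion; ★ row 41b `finite_edgeSet_inside`).

## References
* [SchneiderStuhler1997] P. Schneider, U. Stuhler, *Representation theory and sheaves on the Bruhat–Tits building*, Publ. Math. IHÉS 85 (1997): Ch. I §2 (U1)–(U6), Prop. I.3.1,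
  Ch. III §4 (the action on the coefficient system).
* [Korman2004] J. Korman, *On the local constancy of characters*, arXiv:math/0409292: §3.6 (U1)–(U7), §9 Claim 39.
* [BruhatTits1972] F. Bruhat, J. Tits, *Groupes réductifs sur un corps local* I, Publ. Math. IHÉS 41 (1972): §10 (lattice model; stabilisers are compact open).
* [Serre1980Trees] J.-P. Serre, *Trees* (1980): Ch. I §3.1 (no inversions), Ch. II §1.1–1.3.
-/

set_option autoImplicit false

noncomputable section

open scoped Valued WithZero Matrix MatrixGroups Pointwise

namespace Literature.NumberTheory.Automorphic.UnitaryLatticeTree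

open _root_.SimpleGraph Literature.NumberTheory.Automorphic Literature.NumberTheory.Automorphic.HermitianLattice Literature.NumberTheory.Automorphic.UnitaryGroup
open Literature.NumberTheory.Automorphic.CartanUnique (uniformizer_ne_zero v_uniformizer_zpow v_uniformizer_pow)
open Literature.Combinatorics.SimpleGraph Literature.Combinatorics.SimpleGraph.OrientedIncidence

variable {K : Type*} [Field K] [Valued K ℤᵐ⁰] {N : ℕ} (σ : K →+* K) (ϖ : K) (H : Matrix (Fin N) (Fin N) K)

/-! ## §1 The action hom, the unitary level family, the stabiliser — hypothesis-style objects and their suppliers -/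

/-- **THE ACTION HOM** (41d's letter `a`): `u ↦ latticeGraphIso σ ϖ H u` is a monoid hom `Γ₀ →* (G ≃g G)` (composition = Mathlib's group law on `G ≃g G`). [cite: BruhatTits1972, §10]
[cite: SchneiderStuhler1997, Ch. III §4] -/
theorem exists_monoidHom_latticeGraphIso :
    ∃ a : ↥(unitaryGroupOfForm σ H) →* (latticeGraph σ ϖ H ≃g latticeGraph σ ϖ H), ∀ u, a u = latticeGraphIso σ ϖ H u := by
  refine ⟨{ toFun := latticeGraphIso σ ϖ H, map_one' := ?_, map_mul' := fun u κ => ?_ }, fun u => rfl⟩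
  · exact RelIso.ext fun v => latticeGraphIso_one_apply v
  · exact RelIso.ext fun v => by rw [RelIso.mul_apply]; exact latticeGraphIso_mul_apply u κ v

/-- **THE UNITARY LEVEL FAMILY AT LEVEL `c`** (rows 22∕22b∕δ letters): there is `U : 𝓥 → Subgroup Γ₀` with `u ∈ U x ↔ u·x = x ∧ (u − 1)·x ⊆ c·x`.
[cite: SchneiderStuhler1997, Ch. I §2 (U1)] [cite: Korman2004, §3.6] -/
theorem exists_unitaryLevelFamily (c : K) :
    ∃ U : {M : Submodule 𝒪[K] (Fin N → K) // IsVertex σ ϖ H M} → Subgroup ↥(unitaryGroupOfForm σ H),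
      ∀ (x : {M : Submodule 𝒪[K] (Fin N → K) // IsVertex σ ϖ H M}) (u : ↥(unitaryGroupOfForm σ H)),
        u ∈ U x ↔ mapGL (u : GL (Fin N) K) x.1 = x.1 ∧
          x.1.map ((Matrix.toLin' (((u : GL (Fin N) K) : Matrix (Fin N) (Fin N) K) - 1)).restrictScalars 𝒪[K]) ≤ scaleLattice c x.1 := by
  classical
  refine ⟨fun x => (Classical.choose (exists_subgroup_mem_iff_mapGL_eq_and_map_sub_one_le_scaleLattice c x.1)).comap (unitaryGroupOfForm σ H).subtype, fun x u => ?_⟩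
  rw [Subgroup.mem_comap]
  exact Classical.choose_spec (exists_subgroup_mem_iff_mapGL_eq_and_map_sub_one_le_scaleLattice c x.1) u

/-- **THE STABILISER OF A VERTEX** as a subgroup of `Γ₀`, hypothesis-style supplier: `∃ P, u ∈ P ↔ u·x = x`. [cite: BruhatTits1972, §10] -/
theorem exists_stabilizerSubgroup (x : {M : Submodule 𝒪[K] (Fin N → K) // IsVertex σ ϖ H M}) :
    ∃ P : Subgroup ↥(unitaryGroupOfForm σ H), ∀ u : ↥(unitaryGroupOfForm σ H), u ∈ P ↔ latticeGraphIso σ ϖ H u x = x := by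
  let P : Subgroup ↥(unitaryGroupOfForm σ H) :=
    { carrier := setOf (fun u : ↥(unitaryGroupOfForm σ H) => latticeGraphIso σ ϖ H u x = x)
      one_mem' := latticeGraphIso_one_apply x
      mul_mem' := fun {u} {κ} hu hκ => by
        change latticeGraphIso σ ϖ H (u * κ) x = x
        rw [latticeGraphIso_mul_apply, show latticeGraphIso σ ϖ H κ x = x from hκ]
        exact hu
      inv_mem' := fun {u} hu => by
        change latticeGraphIso σ ϖ H u⁻¹ x = x
        conv_lhs => rw [← show latticeGraphIso σ ϖ H u x = x from hu]
        exact latticeGraphIso_inv_mul_apply u x }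
  exact ⟨P, fun u => Iff.rfl⟩

/-- A vertex is framed: `x.1 = latt g` for some `g ∈ GL_N(K)`. [cite: BruhatTits1972, §10] -/
theorem exists_coe_eq_latt (x : {M : Submodule 𝒪[K] (Fin N → K) // IsVertex σ ϖ H M}) : ∃ g : GL (Fin N) K, x.1 = latt (g : Matrix (Fin N) (Fin N) K) := by
  obtain ⟨_, g, hg, -⟩ := x.2
  exact ⟨g, hg⟩

/-! ## §2 Open ∕ compact: level groups, stabilisers, edge groups -/

section Topology

variable {σ ϖ H}
variable {c : K} {U : {M : Submodule 𝒪[K] (Fin N → K) // IsVertex σ ϖ H M} → Subgroup ↥(unitaryGroupOfForm σ H)}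
  (hU : ∀ (x : {M : Submodule 𝒪[K] (Fin N → K) // IsVertex σ ϖ H M}) (u : ↥(unitaryGroupOfForm σ H)),
    u ∈ U x ↔ mapGL (u : GL (Fin N) K) x.1 = x.1 ∧
      x.1.map ((Matrix.toLin' (((u : GL (Fin N) K) : Matrix (Fin N) (Fin N) K) - 1)).restrictScalars 𝒪[K]) ≤ scaleLattice c x.1)
include hU

/-- At a framed vertex `x.1 = latt g` and level `0 < |c| < 1`, membership in `U x` is the PURE level token (stabiliser automatic, ★ row 22). [cite: SchneiderStuhler1997, Ch. I §2 (U1)] -/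
theorem mem_unitaryLevel_iff_level (hc0 : c ≠ 0) (hc1 : Valued.v c < 1) {x : {M : Submodule 𝒪[K] (Fin N → K) // IsVertex σ ϖ H M}} {g : GL (Fin N) K}
    (hx : x.1 = latt (g : Matrix (Fin N) (Fin N) K)) (u : ↥(unitaryGroupOfForm σ H)) :
    u ∈ U x ↔ (latt (g : Matrix (Fin N) (Fin N) K)).map ((Matrix.toLin' (((u : GL (Fin N) K) : Matrix (Fin N) (Fin N) K) - 1)).restrictScalars 𝒪[K]) ≤
      scaleLattice c (latt (g : Matrix (Fin N) (Fin N) K)) := by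
  rw [hU x u, hx]
  exact ⟨fun h => h.2, fun h => ⟨mapGL_latt_eq_of_map_sub_one_le_scaleLattice hc0 hc1 _ g h, h⟩⟩

/-- **`U x` IS OPEN** (`0 < |c| < 1`). [cite: SchneiderStuhler1997, Ch. I §2 (U1)] [cite: BruhatTits1972, §10] -/
theorem isOpen_coe_unitaryLevel (hc0 : c ≠ 0) (hc1 : Valued.v c < 1) (x : {M : Submodule 𝒪[K] (Fin N → K) // IsVertex σ ϖ H M}) :
    IsOpen (U x : Set ↥(unitaryGroupOfForm σ H)) := by
  obtain ⟨g, hx⟩ := exists_coe_eq_latt σ ϖ H x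
  exact isOpen_coe_of_mem_iff_map_sub_one_latt_le_scaleLattice_unitary σ H hc0 g (mem_unitaryLevel_iff_level hU hc0 hc1 hx)

/-- **`U x` IS COMPACT** (`0 < |c| < 1`, `𝒪` compact, `σ` continuous). [cite: SchneiderStuhler1997, Ch. I §2 (U1)] [cite: BruhatTits1972, §10] -/
theorem isCompact_coe_unitaryLevel [CompactSpace 𝒪[K]] (hσ : Continuous σ) (hc0 : c ≠ 0) (hc1 : Valued.v c < 1)
    (x : {M : Submodule 𝒪[K] (Fin N → K) // IsVertex σ ϖ H M}) : IsCompact (U x : Set ↥(unitaryGroupOfForm σ H)) := by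
  obtain ⟨g, hx⟩ := exists_coe_eq_latt σ ϖ H x
  exact isCompact_coe_of_mem_iff_map_sub_one_latt_le_scaleLattice_unitary σ H hσ hc0 hc1 g (mem_unitaryLevel_iff_level hU hc0 hc1 hx)

/-- **THE EDGE GROUP `U x ⊔ U y` IS OPEN** (it contains the open subgroup `U x`). [cite: SchneiderStuhler1997, Ch. I §2 (U1)] -/
theorem isOpen_coe_sup_unitaryLevel (hc0 : c ≠ 0) (hc1 : Valued.v c < 1) (x y : {M : Submodule 𝒪[K] (Fin N → K) // IsVertex σ ϖ H M}) :
    IsOpen ((U x ⊔ U y : Subgroup ↥(unitaryGroupOfForm σ H)) : Set ↥(unitaryGroupOfForm σ H)) :=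
  Subgroup.isOpen_mono le_sup_left (isOpen_coe_unitaryLevel hU hc0 hc1 x)

end Topology

/-- The vertex-stabiliser set is the pull-back of the `GL`-stabiliser of the lattice. [cite: BruhatTits1972, §10] -/
theorem setOf_latticeGraphIso_apply_eq_eq_preimage (x : {M : Submodule 𝒪[K] (Fin N → K) // IsVertex σ ϖ H M}) :
    {u : ↥(unitaryGroupOfForm σ H) | latticeGraphIso σ ϖ H u x = x} =
      (Subtype.val : ↥(unitaryGroupOfForm σ H) → GL (Fin N) K) ⁻¹' {γ : GL (Fin N) K | mapGL γ x.1 = x.1} := by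
  ext u
  simp only [Set.mem_setOf_eq, Set.mem_preimage]
  rw [← Subtype.coe_inj, latticeGraphIso_apply_coe]
  rfl

/-- **THE VERTEX STABILISER IS OPEN** in `Γ₀` (★ row 43 `isOpen_setOf_mapGL_latt_eq`). [cite: BruhatTits1972, §10] [cite: SchneiderStuhler1997, Ch. I §2] -/
theorem isOpen_setOf_latticeGraphIso_apply_eq (x : {M : Submodule 𝒪[K] (Fin N → K) // IsVertex σ ϖ H M}) :
    IsOpen {u : ↥(unitaryGroupOfForm σ H) | latticeGraphIso σ ϖ H u x = x} := by
  obtain ⟨g, hx⟩ := exists_coe_eq_latt σ ϖ H x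
  rw [setOf_latticeGraphIso_apply_eq_eq_preimage, hx]
  exact (isOpen_setOf_mapGL_latt_eq g).preimage continuous_subtype_val

/-- **THE VERTEX STABILISER IS COMPACT** in `Γ₀` (`𝒪` compact, `σ` continuous: ★ row 43 `isCompact_setOf_mapGL_latt_eq` through the closed embedding `Γ₀ ↪ GL_N(K)`).
[cite: BruhatTits1972, §10] [cite: SchneiderStuhler1997, Ch. I §2] -/
theorem isCompact_setOf_latticeGraphIso_apply_eq [CompactSpace 𝒪[K]] (hσ : Continuous σ) (x : {M : Submodule 𝒪[K] (Fin N → K) // IsVertex σ ϖ H M}) :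
    IsCompact {u : ↥(unitaryGroupOfForm σ H) | latticeGraphIso σ ϖ H u x = x} := by
  obtain ⟨g, hx⟩ := exists_coe_eq_latt σ ϖ H x
  rw [setOf_latticeGraphIso_apply_eq_eq_preimage, hx]
  exact (isClosed_unitaryGroupOfForm hσ H).isClosedEmbedding_subtypeVal.isCompact_preimage (isCompact_setOf_mapGL_latt_eq g)

/-! ## §3 (U6) in the subtype group: `↑(U x ⊔ U y) = ↑(U x) * ↑(U y)` for adjacent vertices of the `U(3)` tree -/

section Three

variable {σ ϖ}
variable {e : ℕ} {U : {M : Submodule 𝒪[K] (Fin 3 → K) // IsVertex σ ϖ ((StdForm.antidiagonal 3).over K) M} → Subgroup ↥(unitaryGroupOfForm σ ((StdForm.antidiagonal 3).over K))}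
  (hU : ∀ (x : {M : Submodule 𝒪[K] (Fin 3 → K) // IsVertex σ ϖ ((StdForm.antidiagonal 3).over K) M}) (u : ↥(unitaryGroupOfForm σ ((StdForm.antidiagonal 3).over K))),
    u ∈ U x ↔ mapGL (u : GL (Fin 3) K) x.1 = x.1 ∧
      x.1.map ((Matrix.toLin' (((u : GL (Fin 3) K) : Matrix (Fin 3) (Fin 3) K) - 1)).restrictScalars 𝒪[K]) ≤ scaleLattice (ϖ ^ (e + 1)) x.1)
include hU

/-- `U x` is the pull-back of the row-22 `GL`-level group of `x.1` at level `ϖ^(e+1)`. [cite: SchneiderStuhler1997, Ch. I §2 (U1)] -/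
theorem unitaryLevel_eq_comap {x : {M : Submodule 𝒪[K] (Fin 3 → K) // IsVertex σ ϖ ((StdForm.antidiagonal 3).over K) M}} {S : Subgroup (GL (Fin 3) K)}
    (hS : ∀ g : GL (Fin 3) K, g ∈ S ↔ mapGL g x.1 = x.1 ∧ x.1.map ((Matrix.toLin' ((g : Matrix (Fin 3) (Fin 3) K) - 1)).restrictScalars 𝒪[K]) ≤ scaleLattice (ϖ ^ (e + 1)) x.1) :
    U x = S.comap (unitaryGroupOfForm σ ((StdForm.antidiagonal 3).over K)).subtype := by
  ext u
  rw [Subgroup.mem_comap, Subgroup.coe_subtype, hS, hU]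

/-- **(U6) IN THE SUBTYPE GROUP, ONE ORIENTATION**: for lattices `ϖ·x ≤ y ≤ x` (an edge of the lattice graph read downward) the unitary level groups at level `ϖ^(e+1)` satisfy
`↑(U x ⊔ U y) = ↑(U x) * ↑(U y)` and `= ↑(U y) * ↑(U x)` (★ row 22b (ii): they normalise each other). [cite: SchneiderStuhler1997, Ch. I §2 (U5)(U6)] [cite: Korman2004, §3.6] -/
theorem coe_sup_unitaryLevel_eq_mul_of_le (hϖ : ϖ ≠ 0) (hϖ1 : Valued.v ϖ ≤ 1)
    {x y : {M : Submodule 𝒪[K] (Fin 3 → K) // IsVertex σ ϖ ((StdForm.antidiagonal 3).over K) M}} (hyx : y.1 ≤ x.1) (hxy : scaleLattice ϖ x.1 ≤ y.1) :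
    ((U x ⊔ U y : Subgroup ↥(unitaryGroupOfForm σ ((StdForm.antidiagonal 3).over K))) : Set ↥(unitaryGroupOfForm σ ((StdForm.antidiagonal 3).over K))) =
        (U x : Set _) * (U y : Set _) ∧
      ((U x ⊔ U y : Subgroup ↥(unitaryGroupOfForm σ ((StdForm.antidiagonal 3).over K))) : Set ↥(unitaryGroupOfForm σ ((StdForm.antidiagonal 3).over K))) =
        (U y : Set _) * (U x : Set _) := by
  obtain ⟨Sx, hSx⟩ := exists_subgroup_mem_iff_mapGL_eq_and_map_sub_one_le_scaleLattice (ϖ ^ (e + 1)) x.1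
  obtain ⟨Sy, hSy⟩ := exists_subgroup_mem_iff_mapGL_eq_and_map_sub_one_le_scaleLattice (ϖ ^ (e + 1)) y.1
  have hx : U x = Sx.comap (unitaryGroupOfForm σ ((StdForm.antidiagonal 3).over K)).subtype := unitaryLevel_eq_comap hU hSx
  have hy : U y = Sy.comap (unitaryGroupOfForm σ ((StdForm.antidiagonal 3).over K)).subtype := unitaryLevel_eq_comap hU hSy
  -- mutual normalisation at the `GL` level (★ row 22b (ii)), restricted to the subtype group
  have hnorm₁ : Sy ≤ Subgroup.normalizer (Sx : Set (GL (Fin 3) K)) := levelSubgroup_le_normalizer_of_edge hϖ hϖ1 hyx hxy hSx hSy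
  have hnorm₂ : Sx ≤ Subgroup.normalizer (Sy : Set (GL (Fin 3) K)) := levelSubgroup_le_normalizer_of_edge' hϖ1 hyx hxy hSx hSy
  have hN₁ : U y ≤ Subgroup.normalizer (U x : Set ↥(unitaryGroupOfForm σ ((StdForm.antidiagonal 3).over K))) := by
    rw [hx, hy]
    intro u hu
    rw [Subgroup.mem_normalizer_iff]
    intro h
    rw [Subgroup.mem_comap, Subgroup.mem_comap]
    exact (Subgroup.mem_normalizer_iff.1 (hnorm₁ (Subgroup.mem_comap.1 hu))) (h : GL (Fin 3) K)
  have hN₂ : U x ≤ Subgroup.normalizer (U y : Set ↥(unitaryGroupOfForm σ ((StdForm.antidiagonal 3).over K))) := by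
    rw [hx, hy]
    intro u hu
    rw [Subgroup.mem_normalizer_iff]
    intro h
    rw [Subgroup.mem_comap, Subgroup.mem_comap]
    exact (Subgroup.mem_normalizer_iff.1 (hnorm₂ (Subgroup.mem_comap.1 hu))) (h : GL (Fin 3) K)
  constructor
  · rw [Subgroup.coe_mul_of_left_le_normalizer_right (U x) (U y) hN₂]
  · rw [sup_comm, Subgroup.coe_mul_of_left_le_normalizer_right (U y) (U x) hN₁]

/-- **(U6) IN THE SUBTYPE GROUP FOR AN EDGE OF THE UNRAMIFIED `U(3)` TREE**: `G.Adj x y → ↑(U x ⊔ U y) = ↑(U x) * ↑(U y)` (at `N = 3` under `UnramifiedLocalConjDatum σ ϖ` an edge is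
`ϖ·M ≤ M′ < M` up to order, ★ `latticeGraph_adj_iff` + ★ `scaleLattice_le_of_lt`). [cite: SchneiderStuhler1997, Ch. I §2 (U6)] [cite: Korman2004, §3.6] [cite: BruhatTits1972, §10] -/
theorem coe_sup_unitaryLevel_eq_mul_of_adj (hd : UnramifiedLocalConjDatum σ ϖ)
    {x y : {M : Submodule 𝒪[K] (Fin 3 → K) // IsVertex σ ϖ ((StdForm.antidiagonal 3).over K) M}} (hxy : (latticeGraph σ ϖ ((StdForm.antidiagonal 3).over K)).Adj x y) :
    ((U x ⊔ U y : Subgroup ↥(unitaryGroupOfForm σ ((StdForm.antidiagonal 3).over K))) : Set ↥(unitaryGroupOfForm σ ((StdForm.antidiagonal 3).over K))) =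
      (U x : Set _) * (U y : Set _) := by
  have hϖ0 : ϖ ≠ 0 := uniformizer_ne_zero hd.vϖ
  have hϖ1 : Valued.v ϖ ≤ 1 := v_le_one_of_v_eq_exp_neg_one hd.vϖ
  have hH : IsUnit ((StdForm.antidiagonal 3).over K).det := isUnit_det_antidiagonal
  rcases (latticeGraph_adj_iff σ ϖ _ x y).1 hxy with hlt | hlt
  · -- `x < y`: `ϖ·y ≤ x ≤ y`
    obtain ⟨d', hd'⟩ := y.2
    have h := coe_sup_unitaryLevel_eq_mul_of_le hU hϖ0 hϖ1 hlt.le (scaleLattice_le_of_lt hd.vσ hH x.2 hd' hlt.le)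
    rw [sup_comm]; exact h.2
  · -- `y < x`: `ϖ·x ≤ y ≤ x`
    obtain ⟨d', hd'⟩ := x.2
    exact (coe_sup_unitaryLevel_eq_mul_of_le hU hϖ0 hϖ1 hlt.le (scaleLattice_le_of_lt hd.vσ hH y.2 hd' hlt.le)).1

/-- **THE EDGE GROUP IS COMPACT** (`↑(U x ⊔ U y) = ↑(U x) * ↑(U y)`, a product of compacts). [cite: SchneiderStuhler1997, Ch. I §2 (U1)(U6)] -/
theorem isCompact_coe_sup_unitaryLevel_of_adj [CompactSpace 𝒪[K]] (hσ : Continuous σ) (hd : UnramifiedLocalConjDatum σ ϖ)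
    {x y : {M : Submodule 𝒪[K] (Fin 3 → K) // IsVertex σ ϖ ((StdForm.antidiagonal 3).over K) M}} (hxy : (latticeGraph σ ϖ ((StdForm.antidiagonal 3).over K)).Adj x y) :
    IsCompact ((U x ⊔ U y : Subgroup ↥(unitaryGroupOfForm σ ((StdForm.antidiagonal 3).over K))) : Set ↥(unitaryGroupOfForm σ ((StdForm.antidiagonal 3).over K))) := by
  have hc0 : ϖ ^ (e + 1) ≠ 0 := pow_ne_zero _ (uniformizer_ne_zero hd.vϖ)
  have hc1 : Valued.v (ϖ ^ (e + 1)) < 1 := by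
    rw [v_uniformizer_pow hd.vϖ, ← WithZero.exp_zero, WithZero.exp_lt_exp]; omega
  rw [coe_sup_unitaryLevel_eq_mul_of_adj hU hd hxy]
  exact (isCompact_coe_unitaryLevel hU hσ hc0 hc1 x).mul (isCompact_coe_unitaryLevel hU hσ hc0 hc1 y)

/-! ## §4 Transport `U (u·x) = u U_x u⁻¹`, normalisers, and «level ≥ 1 fixes the closed star» -/

/-- **TRANSPORT**: `U (u·x) = (U x).map (conj u)` — 41d's `hUa` at the datum (★ δ §1 `mem_unitaryLevel_mapGL_iff` as a subgroup equality).
[cite: SchneiderStuhler1997, Ch. I §2 (U3)] [cite: Korman2004, §3.6] -/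
theorem unitaryLevel_latticeGraphIso_eq_map_conj (u : ↥(unitaryGroupOfForm σ ((StdForm.antidiagonal 3).over K)))
    (x : {M : Submodule 𝒪[K] (Fin 3 → K) // IsVertex σ ϖ ((StdForm.antidiagonal 3).over K) M}) :
    U (latticeGraphIso σ ϖ ((StdForm.antidiagonal 3).over K) u x) = (U x).map (MulAut.conj u).toMonoidHom := by
  ext g
  rw [Subgroup.mem_map_equiv, MulAut.conj_symm_apply, hU, hU, latticeGraphIso_apply_val, Subgroup.coe_mul, Subgroup.coe_mul, Subgroup.coe_inv]
  conv_lhs => rw [← conj_inv_conj (u : GL (Fin 3) K) (g : GL (Fin 3) K)]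
  rw [map_conj_sub_one_le_scaleLattice_mapGL_iff, mapGL_conj_mapGL_eq_iff]

/-- **A MEMBER OF `U x` FIXES `x`.** [cite: SchneiderStuhler1997, Ch. I §2 (U1)] -/
theorem latticeGraphIso_apply_eq_of_mem_unitaryLevel {u : ↥(unitaryGroupOfForm σ ((StdForm.antidiagonal 3).over K))}
    {x : {M : Submodule 𝒪[K] (Fin 3 → K) // IsVertex σ ϖ ((StdForm.antidiagonal 3).over K) M}} (hu : u ∈ U x) :
    latticeGraphIso σ ϖ ((StdForm.antidiagonal 3).over K) u x = x :=
  Subtype.ext (by rw [latticeGraphIso_apply_coe]; exact ((hU x u).1 hu).1)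

/-- **AN ELEMENT FIXING `x` NORMALISES `U x`** (transport with `u·x = x`). [cite: SchneiderStuhler1997, Ch. I §2 (U3)] [cite: Korman2004, §3.6 (U2)] -/
theorem mem_normalizer_unitaryLevel_of_apply_eq {u : ↥(unitaryGroupOfForm σ ((StdForm.antidiagonal 3).over K))}
    {x : {M : Submodule 𝒪[K] (Fin 3 → K) // IsVertex σ ϖ ((StdForm.antidiagonal 3).over K) M}} (hx : latticeGraphIso σ ϖ ((StdForm.antidiagonal 3).over K) u x = x) :
    u ∈ Subgroup.normalizer (U x : Set ↥(unitaryGroupOfForm σ ((StdForm.antidiagonal 3).over K))) := by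
  have h := unitaryLevel_latticeGraphIso_eq_map_conj hU u x
  rw [hx] at h
  rw [Subgroup.mem_normalizer_iff]
  intro g
  conv_rhs => rw [h]
  rw [Subgroup.mem_map_equiv, MulAut.conj_symm_apply, ← mul_assoc, ← mul_assoc, inv_mul_cancel, one_mul, inv_mul_cancel_right]

/-- **LEVEL `≥ 1` FIXES THE CLOSED STAR**: a member of `U x` (level `ϖ^(e+1)`) fixes every neighbour of `x` (★ row 22b (i): it acts trivially on `M∕ϖM`, through which both edge
shapes factor). [cite: SchneiderStuhler1997, Ch. I §2 (U4)] [cite: Korman2004, §9 Claim 39] [cite: BruhatTits1972, §10] -/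
theorem latticeGraphIso_apply_eq_of_mem_unitaryLevel_of_adj (hd : UnramifiedLocalConjDatum σ ϖ) {u : ↥(unitaryGroupOfForm σ ((StdForm.antidiagonal 3).over K))}
    {x y : {M : Submodule 𝒪[K] (Fin 3 → K) // IsVertex σ ϖ ((StdForm.antidiagonal 3).over K) M}} (hu : u ∈ U x)
    (hxy : (latticeGraph σ ϖ ((StdForm.antidiagonal 3).over K)).Adj x y) : latticeGraphIso σ ϖ ((StdForm.antidiagonal 3).over K) u y = y := by
  have hϖ0 : ϖ ≠ 0 := uniformizer_ne_zero hd.vϖ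
  have hϖ1 : Valued.v ϖ ≤ 1 := v_le_one_of_v_eq_exp_neg_one hd.vϖ
  obtain ⟨Sx, hSx⟩ := exists_subgroup_mem_iff_mapGL_eq_and_map_sub_one_le_scaleLattice (ϖ ^ (e + 1)) x.1
  have hux : (u : GL (Fin 3) K) ∈ Sx := (hSx _).2 ((hU x u).1 hu)
  have hH : IsUnit ((StdForm.antidiagonal 3).over K).det := isUnit_det_antidiagonal
  apply Subtype.ext
  rw [latticeGraphIso_apply_val]
  rcases (latticeGraph_adj_iff σ ϖ _ x y).1 hxy with hlt | hlt
  · -- `x < y`: `ϖ·y ≤ x ≤ y`, `u` at level `≥ 1` on `x` fixes `y` (★ 22b (i)′)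
    obtain ⟨d', hd'⟩ := y.2
    exact mapGL_eq_of_mem_levelSubgroup_succ_of_edge' hϖ0 hϖ1 hlt.le (scaleLattice_le_of_lt hd.vσ hH x.2 hd' hlt.le) hSx hux
  · -- `y < x`: `ϖ·x ≤ y ≤ x` (★ 22b (i))
    obtain ⟨d', hd'⟩ := x.2
    exact mapGL_eq_of_mem_levelSubgroup_succ_of_edge hϖ1 hlt.le (scaleLattice_le_of_lt hd.vσ hH y.2 hd' hlt.le) hSx hux

end Three

/-! ## §5 Fixed edges are finite when fixed vertices are -/

/-- Under an orientation with `tail < head` (★ row 30b), an edge mapped to itself by `u` has BOTH endpoints fixed (no inversion: heads go to heads). [cite: Serre1980Trees, Ch. I §3.1]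
[cite: SchneiderStuhler1997, Ch. III §4] -/
theorem head_eq_and_tail_eq_of_mapEdgeSet_eq {τ : Orientation (latticeGraph σ ϖ H)} (hτ : ∀ d, τ.tail d < τ.head d) (u : ↥(unitaryGroupOfForm σ H))
    {d : (latticeGraph σ ϖ H).edgeSet} (hd : (latticeGraphIso σ ϖ H u).mapEdgeSet d = d) :
    latticeGraphIso σ ϖ H u (τ.head d) = τ.head d ∧ latticeGraphIso σ ϖ H u (τ.tail d) = τ.tail d := by
  obtain ⟨h1, h2⟩ := head_mapEdgeSet_latticeGraphIso σ ϖ H hτ u d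
  rw [hd] at h1 h2
  exact ⟨h1.symm, h2.symm⟩

/-- **FINITE FIXED EDGES FROM FINITE FIXED VERTICES** (41f's edge sum is finite at an elliptic `γ`): `{d | u·d = d} ⊆ {d | both ends of d are u-fixed}`, finite by ★ row 41b
`finite_edgeSet_inside`. [cite: Serre1980Trees, Ch. I §6.4] [cite: SchneiderStuhler1997, Ch. III §4] -/
theorem finite_setOf_mapEdgeSet_eq_of_finite {τ : Orientation (latticeGraph σ ϖ H)} (hτ : ∀ d, τ.tail d < τ.head d) (u : ↥(unitaryGroupOfForm σ H))
    (hfin : {x : {M : Submodule 𝒪[K] (Fin N → K) // IsVertex σ ϖ H M} | latticeGraphIso σ ϖ H u x = x}.Finite) :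
    {d : (latticeGraph σ ϖ H).edgeSet | (latticeGraphIso σ ϖ H u).mapEdgeSet d = d}.Finite := by
  refine (ClosedBall.finite_edgeSet_inside (G := latticeGraph σ ϖ H) hfin).subset fun d hd => ?_
  intro z hz
  obtain ⟨hh, ht⟩ := head_eq_and_tail_eq_of_mapEdgeSet_eq σ ϖ H hτ u hd
  rcases τ.mem_iff.1 hz with rfl | rfl
  · exact hh
  · exact ht

/-! ## §6 PLACE-FREE TWINS of the three `UnramifiedLocalConjDatum`-reading lemmas of §3–§4 (E1 row B2 «41g-RAM»): the proofs only read `|σ a| = |a|` and `|ϖ| = q⁻¹`,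
so the same statements hold for ANY isometric `σ` and uniformiser `ϖ` — in particular at a tame ramified place (`σ ϖ = −ϖ`). -/

section ThreeOfV

variable {σ ϖ}
variable {e : ℕ} {U : {M : Submodule 𝒪[K] (Fin 3 → K) // IsVertex σ ϖ ((StdForm.antidiagonal 3).over K) M} → Subgroup ↥(unitaryGroupOfForm σ ((StdForm.antidiagonal 3).over K))}
  (hU : ∀ (x : {M : Submodule 𝒪[K] (Fin 3 → K) // IsVertex σ ϖ ((StdForm.antidiagonal 3).over K) M}) (u : ↥(unitaryGroupOfForm σ ((StdForm.antidiagonal 3).over K))),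
    u ∈ U x ↔ mapGL (u : GL (Fin 3) K) x.1 = x.1 ∧
      x.1.map ((Matrix.toLin' (((u : GL (Fin 3) K) : Matrix (Fin 3) (Fin 3) K) - 1)).restrictScalars 𝒪[K]) ≤ scaleLattice (ϖ ^ (e + 1)) x.1)
include hU

/-- **(U6) FOR AN EDGE, PLACE-FREE** (`|σ a| = |a|`, `|ϖ| = q⁻¹`): `G.Adj x y → ↑(U x ⊔ U y) = ↑(U x) * ↑(U y)` — ★ `coe_sup_unitaryLevel_eq_mul_of_adj`'s conclusion VERBATIM, its
`UnramifiedLocalConjDatum` binder replaced by `hvσ hϖ`. [cite: SchneiderStuhler1997, Ch. I §2 (U6)] [cite: Korman2004, §3.6] [cite: BruhatTits1972, §10] -/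
theorem coe_sup_unitaryLevel_eq_mul_of_adj_of_v (hvσ : ∀ a, Valued.v (σ a) = Valued.v a) (hϖ : Valued.v ϖ = WithZero.exp (-1 : ℤ))
    {x y : {M : Submodule 𝒪[K] (Fin 3 → K) // IsVertex σ ϖ ((StdForm.antidiagonal 3).over K) M}} (hxy : (latticeGraph σ ϖ ((StdForm.antidiagonal 3).over K)).Adj x y) :
    ((U x ⊔ U y : Subgroup ↥(unitaryGroupOfForm σ ((StdForm.antidiagonal 3).over K))) : Set ↥(unitaryGroupOfForm σ ((StdForm.antidiagonal 3).over K))) =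
      (U x : Set _) * (U y : Set _) := by
  have hϖ0 : ϖ ≠ 0 := uniformizer_ne_zero hϖ
  have hϖ1 : Valued.v ϖ ≤ 1 := v_le_one_of_v_eq_exp_neg_one hϖ
  have hH : IsUnit ((StdForm.antidiagonal 3).over K).det := isUnit_det_antidiagonal
  rcases (latticeGraph_adj_iff σ ϖ _ x y).1 hxy with hlt | hlt
  · obtain ⟨d', hd'⟩ := y.2
    have h := coe_sup_unitaryLevel_eq_mul_of_le hU hϖ0 hϖ1 hlt.le (scaleLattice_le_of_lt hvσ hH x.2 hd' hlt.le)
    rw [sup_comm]; exact h.2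
  · obtain ⟨d', hd'⟩ := x.2
    exact (coe_sup_unitaryLevel_eq_mul_of_le hU hϖ0 hϖ1 hlt.le (scaleLattice_le_of_lt hvσ hH y.2 hd' hlt.le)).1

/-- **THE EDGE GROUP IS COMPACT, PLACE-FREE** (`↑(U x ⊔ U y) = ↑(U x) * ↑(U y)`, a product of compacts). [cite: SchneiderStuhler1997, Ch. I §2 (U1)(U6)] -/
theorem isCompact_coe_sup_unitaryLevel_of_adj_of_v [CompactSpace 𝒪[K]] (hσ : Continuous σ) (hvσ : ∀ a, Valued.v (σ a) = Valued.v a)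
    (hϖ : Valued.v ϖ = WithZero.exp (-1 : ℤ))
    {x y : {M : Submodule 𝒪[K] (Fin 3 → K) // IsVertex σ ϖ ((StdForm.antidiagonal 3).over K) M}} (hxy : (latticeGraph σ ϖ ((StdForm.antidiagonal 3).over K)).Adj x y) :
    IsCompact ((U x ⊔ U y : Subgroup ↥(unitaryGroupOfForm σ ((StdForm.antidiagonal 3).over K))) : Set ↥(unitaryGroupOfForm σ ((StdForm.antidiagonal 3).over K))) := by
  have hc0 : ϖ ^ (e + 1) ≠ 0 := pow_ne_zero _ (uniformizer_ne_zero hϖ)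
  have hc1 : Valued.v (ϖ ^ (e + 1)) < 1 := by
    rw [v_uniformizer_pow hϖ, ← WithZero.exp_zero, WithZero.exp_lt_exp]; omega
  rw [coe_sup_unitaryLevel_eq_mul_of_adj_of_v hU hvσ hϖ hxy]
  exact (isCompact_coe_unitaryLevel hU hσ hc0 hc1 x).mul (isCompact_coe_unitaryLevel hU hσ hc0 hc1 y)

/-- **LEVEL `≥ 1` FIXES THE CLOSED STAR, PLACE-FREE**: a member of `U x` (level `ϖ^(e+1)`) fixes every neighbour of `x` — ★ `latticeGraphIso_apply_eq_of_mem_unitaryLevel_of_adj`'s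
conclusion VERBATIM under `hvσ hϖ`. [cite: SchneiderStuhler1997, Ch. I §2 (U4)] [cite: Korman2004, §9 Claim 39] [cite: BruhatTits1972, §10] -/
theorem latticeGraphIso_apply_eq_of_mem_unitaryLevel_of_adj_of_v (hvσ : ∀ a, Valued.v (σ a) = Valued.v a) (hϖ : Valued.v ϖ = WithZero.exp (-1 : ℤ))
    {u : ↥(unitaryGroupOfForm σ ((StdForm.antidiagonal 3).over K))}
    {x y : {M : Submodule 𝒪[K] (Fin 3 → K) // IsVertex σ ϖ ((StdForm.antidiagonal 3).over K) M}} (hu : u ∈ U x)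
    (hxy : (latticeGraph σ ϖ ((StdForm.antidiagonal 3).over K)).Adj x y) : latticeGraphIso σ ϖ ((StdForm.antidiagonal 3).over K) u y = y := by
  have hϖ0 : ϖ ≠ 0 := uniformizer_ne_zero hϖ
  have hϖ1 : Valued.v ϖ ≤ 1 := v_le_one_of_v_eq_exp_neg_one hϖ
  obtain ⟨Sx, hSx⟩ := exists_subgroup_mem_iff_mapGL_eq_and_map_sub_one_le_scaleLattice (ϖ ^ (e + 1)) x.1
  have hux : (u : GL (Fin 3) K) ∈ Sx := (hSx _).2 ((hU x u).1 hu)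
  have hH : IsUnit ((StdForm.antidiagonal 3).over K).det := isUnit_det_antidiagonal
  apply Subtype.ext
  rw [latticeGraphIso_apply_val]
  rcases (latticeGraph_adj_iff σ ϖ _ x y).1 hxy with hlt | hlt
  · obtain ⟨d', hd'⟩ := y.2
    exact mapGL_eq_of_mem_levelSubgroup_succ_of_edge' hϖ0 hϖ1 hlt.le (scaleLattice_le_of_lt hvσ hH x.2 hd' hlt.le) hSx hux
  · obtain ⟨d', hd'⟩ := x.2
    exact mapGL_eq_of_mem_levelSubgroup_succ_of_edge hϖ1 hlt.le (scaleLattice_le_of_lt hvσ hH y.2 hd' hlt.le) hSx hux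

end ThreeOfV

end Literature.NumberTheory.Automorphic.UnitaryLatticeTree

end
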